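import Summits.AnomalousDissipation.AnomalousDissipation.Theorems.SolenoidalFractalHomogenisationRealisedQuasiStaticCellLawCellLadder
import HarnessLib

/-!
# K2R `RealisedQuasiStaticCellLaw`, line `floquet-bloch`: slot windows of a lattice word and the single-layer form of the
# cell's Galerkin system inside a slot (helper towards `stub_lowSectorDecay` / `stub_upperSome`; `--supports stmt-AnomalousDissipation-20446`)

Summits-side helper file (everything proved; no definitions, no named facts). Elementary time structure of a lattice
shear word `W` (`LatticeShearWords`): the slots `[start j, start j + τ_j]` tile the period, so inside slot `j` every other
envelope vanishes (`trapezoid_eq_zero_of_ne`); the trapezoid envelope equals `1` on the middle of the slot and is `≥ 1/2`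
on the middle half-ramps (`trapezoid_eq_one`, `half_le_trapezoid`); stretching a word rescales time
(`carrier_stretch`, `cell_stretch`: `(W.stretch s).cell n t = W.cell n (t/s)`). Consequently, inside slot `j` the Fourier
coefficients of the cell slice are those of ONE Kolmogorov layer (`mFourierCoeff_cell_slot`), they vanish off `±K_j`
(`mFourierCoeff_cell_slot_eq_zero`), and the Galerkin field around the cell is the single-layer ladder of
`Torus.pvGalerkinField_layer` with the envelope weight of the slot (`pvGalerkinField_cell_slot`) — the «standard ladder of
slot j» of STUB-PLAN `stub_lowSectorDecay` §1, before gauge and time normalisation.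
-/

set_option linter.dupNamespace false

noncomputable section

namespace Summit.AnomalousDissipation.AnomalousDissipation.Theorems.SolenoidalFractalHomogenisation.RealisedQuasiStaticCellLaw

open Set MeasureTheory Filter Topology Function
open scoped InnerProductSpace
open Literature.Analysis Literature.Analysis.FunctionSpaces Literature.Analysis.FunctionSpaces.Torus
open Literature.Analysis.FluidPDE Literature.Analysis.FluidPDE.LatticeShear
open Summit.AnomalousDissipation.AnomalousDissipation.Theorems.SolenoidalFractalHomogenisation.PermissibleCarrier

variable {k₀ : ℕ}

/-! ### Slots tile the period -/

/-- An earlier slot ends before a later slot starts: `start i + τ_i ≤ start j` for `i < j`. -/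
theorem start_add_tau_le_start (W : LatticeWord k₀) {i j : Fin k₀} (hij : i < j) :
    W.start i + (W.phase i).τ ≤ W.start j := by
  unfold LatticeWord.start
  have hi : i ∉ Finset.univ.filter (· < i) := by simp
  have hsub : insert i (Finset.univ.filter (· < i)) ⊆ Finset.univ.filter (· < j) := by
    intro l hl
    rw [Finset.mem_insert] at hl
    rw [Finset.mem_filter]
    rcases hl with rfl | hl
    · exact ⟨Finset.mem_univ _, hij⟩
    · rw [Finset.mem_filter] at hl
      exact ⟨Finset.mem_univ _, hl.2.trans hij⟩
  calc ∑ l ∈ Finset.univ.filter (· < i), (W.phase l).τ + (W.phase i).τ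
      = ∑ l ∈ insert i (Finset.univ.filter (· < i)), (W.phase l).τ := by rw [Finset.sum_insert hi, add_comm]
    _ ≤ ∑ l ∈ Finset.univ.filter (· < j), (W.phase l).τ :=
        Finset.sum_le_sum_of_subset_of_nonneg hsub fun l _ _ => (W.phase l).τ_pos.le

/-- **Inside slot `j` every other envelope vanishes.** -/
theorem trapezoid_eq_zero_of_ne (W : LatticeWord k₀) {i j : Fin k₀} (hij : i ≠ j) {r : ℝ}
    (hr : r ∈ Icc (W.start j) (W.start j + (W.phase j).τ)) :
    LatticeWord.trapezoid (W.start i) (W.phase i).τ W.ramp r = 0 := by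
  have hρτ : 0 < W.ramp * (W.phase i).τ := mul_pos W.ramp_pos (W.phase i).τ_pos
  rcases lt_or_gt_of_ne hij with h | h
  · exact trapezoid_eq_zero_of_ge hρτ ((start_add_tau_le_start W h).trans hr.1)
  · exact trapezoid_eq_zero_of_le hρτ (hr.2.trans (start_add_tau_le_start W h))

/-! ### The envelope on the middle of a slot -/

/-- A lower bound for the trapezoid: `min 1 (min ((s-a)/(ρτ)) ((a+τ-s)/(ρτ))) ≤ trapezoid a τ ρ s`. -/
theorem min_le_trapezoid (a τ ρ s : ℝ) :
    min 1 (min ((s - a) / (ρ * τ)) ((a + τ - s) / (ρ * τ))) ≤ LatticeWord.trapezoid a τ ρ s :=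
  le_max_right _ _

/-- **The envelope is `1` on the middle of the slot** `[a + ρτ, a + τ - ρτ]` (`ρτ > 0`). -/
theorem trapezoid_eq_one {a τ ρ s : ℝ} (hρτ : 0 < ρ * τ) (hs : s ∈ Icc (a + ρ * τ) (a + τ - ρ * τ)) :
    LatticeWord.trapezoid a τ ρ s = 1 := by
  have h1 : 1 ≤ (s - a) / (ρ * τ) := by rw [le_div_iff₀ hρτ]; linarith [hs.1]
  have h2 : 1 ≤ (a + τ - s) / (ρ * τ) := by rw [le_div_iff₀ hρτ]; linarith [hs.2]
  unfold LatticeWord.trapezoid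
  rw [min_eq_left (le_min h1 h2), max_eq_right zero_le_one]

/-- **The envelope is at least `1/2` on the middle half-ramps** `[a + ρτ/2, a + τ - ρτ/2]` (`ρτ > 0`). -/
theorem half_le_trapezoid {a τ ρ s : ℝ} (hρτ : 0 < ρ * τ) (hs : s ∈ Icc (a + ρ * τ / 2) (a + τ - ρ * τ / 2)) :
    1 / 2 ≤ LatticeWord.trapezoid a τ ρ s := by
  have h1 : 1 / 2 ≤ (s - a) / (ρ * τ) := by rw [le_div_iff₀ hρτ]; linarith [hs.1]
  have h2 : 1 / 2 ≤ (a + τ - s) / (ρ * τ) := by rw [le_div_iff₀ hρτ]; linarith [hs.2]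
  refine le_trans ?_ (min_le_trapezoid a τ ρ s)
  exact le_min (by norm_num) (le_min h1 h2)

/-! ### Stretching rescales time -/

/-- Slot starts of a stretched word. -/
theorem start_stretch (W : LatticeWord k₀) (s : ℝ) (hs : 0 < s) (j : Fin k₀) :
    (W.stretch s hs).start j = s * W.start j := by
  unfold LatticeWord.start LatticeWord.stretch
  simp [Finset.mul_sum]

/-- The trapezoid is invariant under a common positive rescaling of start, duration and time. -/
theorem trapezoid_stretch {s : ℝ} (hs : 0 < s) (a τ ρ r : ℝ) :
    LatticeWord.trapezoid (s * a) (s * τ) ρ (s * r) = LatticeWord.trapezoid a τ ρ r := by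
  unfold LatticeWord.trapezoid
  have e1 : (s * r - s * a) / (ρ * (s * τ)) = (r - a) / (ρ * τ) := by
    rw [← mul_sub, mul_left_comm, mul_div_mul_left _ _ hs.ne']
  have e2 : (s * a + s * τ - s * r) / (ρ * (s * τ)) = (a + τ - r) / (ρ * τ) := by
    rw [← mul_add, ← mul_sub, mul_left_comm, mul_div_mul_left _ _ hs.ne']
  rw [e1, e2]

/-- **Stretching a word rescales the time of its carrier**: `(W.stretch s).carrier t = W.carrier (t/s)`. -/
theorem carrier_stretch (W : LatticeWord k₀) (s : ℝ) (hs : 0 < s) (t : ℝ) :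
    (W.stretch s hs).carrier t = W.carrier (t / s) := by
  funext x
  have hP : (W.stretch s hs).period = s * W.period := by
    unfold LatticeWord.period LatticeWord.stretch
    simp [Finset.mul_sum]
  have hr : Int.fract (t / (W.stretch s hs).period) * (W.stretch s hs).period =
      s * (Int.fract (t / s / W.period) * W.period) := by
    rw [hP, div_div]
    ring
  simp only [LatticeWord.carrier]
  rw [hr]
  refine Finset.sum_congr rfl fun j _ => ?_
  rw [start_stretch]
  change LatticeWord.trapezoid (s * W.start j) (s * (W.phase j).τ) W.ramp
      (s * (Int.fract (t / s / W.period) * W.period)) • (W.phase j).layer x = _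
  rw [trapezoid_stretch hs]

/-- **Stretching a word rescales the time of its cells**: `(W.stretch s).cell n t = W.cell n (t/s)`. -/
theorem cell_stretch (W : LatticeWord k₀) (s : ℝ) (hs : 0 < s) (n : ℕ) (t : ℝ) :
    (W.stretch s hs).cell n t = W.cell n (t / s) := by
  funext x
  simp only [LatticeWord.cell, carrier_stretch]

/-! ### Inside a slot the cell is one Kolmogorov layer -/

/-- **Fourier coefficients of the cell slice inside slot `j`**: with `r = fract(t/P)·P ∈ [start j, start j + τ_j]`,
`𝓕(cell t)(k) = ((1/n)·trap_j(r)) • C_j(k)`, the two-mode coefficient family of the single active layer. -/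
theorem mFourierCoeff_cell_slot (W : LatticeWord k₀) {n : ℕ} (hn : 0 < n) {t : ℝ} (j : Fin k₀)
    (ht : Int.fract (t / W.period) * W.period ∈ Icc (W.start j) (W.start j + (W.phase j).τ)) (k : Fin 3 → ℤ) :
    UnitAddTorus.mFourierCoeff (EuclideanSpace.complexify ∘ W.cell n t) k =
      (((1 / (n : ℝ)) *
          LatticeWord.trapezoid (W.start j) (W.phase j).τ W.ramp (Int.fract (t / W.period) * W.period) : ℝ) : ℂ) •
        (((if k = (fun i => (W.phase j).m i * n) then
            Complex.exp ((W.phase j).φ * Complex.I) *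
              (1 / (2 * ((2 * Real.pi * ‖latticeVec (W.phase j).m‖ : ℝ) : ℂ) * Complex.I)) else 0) +
          (if k = -(fun i => (W.phase j).m i * n) then
            starRingEnd ℂ (Complex.exp ((W.phase j).φ * Complex.I)) *
              (-(1 / (2 * ((2 * Real.pi * ‖latticeVec (W.phase j).m‖ : ℝ) : ℂ) * Complex.I))) else 0)) •
          EuclideanSpace.complexify (W.phase j).e) := by
  rw [mFourierCoeff_cell W hn t k]
  refine Finset.sum_eq_single j (fun i _ hij => ?_) (fun h => absurd (Finset.mem_univ j) h)
  rw [trapezoid_eq_zero_of_ne W hij ht, mul_zero, Complex.ofReal_zero, zero_smul]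

/-- Inside slot `j` the Fourier coefficients of the cell slice vanish off `±K_j` (`K_j i = m_j i · n`). -/
theorem mFourierCoeff_cell_slot_eq_zero (W : LatticeWord k₀) {n : ℕ} (hn : 0 < n) {t : ℝ} (j : Fin k₀)
    (ht : Int.fract (t / W.period) * W.period ∈ Icc (W.start j) (W.start j + (W.phase j).τ)) {k : Fin 3 → ℤ}
    (hk : k ≠ (fun i => (W.phase j).m i * n)) (hk' : k ≠ -(fun i => (W.phase j).m i * n)) :
    UnitAddTorus.mFourierCoeff (EuclideanSpace.complexify ∘ W.cell n t) k = 0 := by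
  rw [mFourierCoeff_cell_slot W hn j ht k, if_neg hk, if_neg hk', add_zero, zero_smul, smul_zero]

/-- **The Galerkin field around the cell inside slot `j` is the single-layer ladder** (`Torus.pvGalerkinField_layer`):
for a symmetric frequency set `S ∋ ±K_j` and states `c` vanishing off `S`,
`V(c)_k = -κ4π²|k|² c_k - ((1/n)trap_j(r) · 2πi(ê_j·k)) • Π_k (a_j • c(k - K_j) + a'_j • c(k + K_j))`. -/
theorem pvGalerkinField_cell_slot (W : LatticeWord k₀) {n : ℕ} (hn : 0 < n) (κ : ℝ) {t : ℝ} (j : Fin k₀)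
    (ht : Int.fract (t / W.period) * W.period ∈ Icc (W.start j) (W.start j + (W.phase j).τ))
    {S : Finset (Fin 3 → ℤ)} (hKS : (fun i => (W.phase j).m i * (n : ℤ)) ∈ S)
    (hKS' : -(fun i => (W.phase j).m i * (n : ℤ)) ∈ S)
    {c : (Fin 3 → ℤ) → EuclideanSpace ℂ (Fin 3)} (hc : ∀ m, m ∉ S → c m = 0) (k : Fin 3 → ℤ) :
    Torus.pvGalerkinField κ S (fun l => UnitAddTorus.mFourierCoeff (EuclideanSpace.complexify ∘ W.cell n t) l) c k =
      -(((κ * (4 * Real.pi ^ 2 * freqNormSq k) : ℝ) : ℂ) • c k) -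
        ((((1 / (n : ℝ)) *
            LatticeWord.trapezoid (W.start j) (W.phase j).τ W.ramp (Int.fract (t / W.period) * W.period) : ℝ) : ℂ) *
            (2 * Real.pi * Complex.I * ∑ i, (EuclideanSpace.complexify (W.phase j).e) i * (k i : ℂ))) •
          Torus.leraySym k
            ((Complex.exp ((W.phase j).φ * Complex.I) *
                (1 / (2 * ((2 * Real.pi * ‖latticeVec (W.phase j).m‖ : ℝ) : ℂ) * Complex.I))) •
                c (k - (fun i => (W.phase j).m i * n)) +
              (starRingEnd ℂ (Complex.exp ((W.phase j).φ * Complex.I)) *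
                (-(1 / (2 * ((2 * Real.pi * ‖latticeVec (W.phase j).m‖ : ℝ) : ℂ) * Complex.I)))) •
                c (k + (fun i => (W.phase j).m i * n))) := by
  classical
  have e1 : (fun l => UnitAddTorus.mFourierCoeff (EuclideanSpace.complexify ∘ W.cell n t) l) =
      fun l => ∑ i ∈ ({j} : Finset (Fin k₀)), (((1 / (n : ℝ)) *
          LatticeWord.trapezoid (W.start i) (W.phase i).τ W.ramp (Int.fract (t / W.period) * W.period) : ℝ) : ℂ) •
        (((if l = (fun i' => (W.phase i).m i' * n) then
            Complex.exp ((W.phase i).φ * Complex.I) *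
              (1 / (2 * ((2 * Real.pi * ‖latticeVec (W.phase i).m‖ : ℝ) : ℂ) * Complex.I)) else 0) +
          (if l = -(fun i' => (W.phase i).m i' * n) then
            starRingEnd ℂ (Complex.exp ((W.phase i).φ * Complex.I)) *
              (-(1 / (2 * ((2 * Real.pi * ‖latticeVec (W.phase i).m‖ : ℝ) : ℂ) * Complex.I))) else 0)) •
          EuclideanSpace.complexify (W.phase i).e) := by
    funext l
    rw [Finset.sum_singleton, mFourierCoeff_cell_slot W hn j ht l]
  rw [e1, Torus.pvGalerkinField_layers κ {j} (fun i _ => cellFreq_ne_zero (W.phase i) hn)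
    (fun i hi => by rw [Finset.mem_singleton.1 hi]; exact hKS) (fun i hi => by rw [Finset.mem_singleton.1 hi]; exact hKS')
    (fun i _ => sum_cellFreq_mul_complexify_e (W.phase i) n) _ _ _ hc k, Finset.sum_singleton]

end Summit.AnomalousDissipation.AnomalousDissipation.Theorems.SolenoidalFractalHomogenisation.RealisedQuasiStaticCellLaw

end
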